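import Literature.Computability.MetaComplexity.EFNetlist
import HarnessLib

/-!
# The ripple-carry adder in extended Frege: template, views, commutativity

Layer C (arithmetic netlists) of the `EF`-proof construction kit (`EFScaffold.lean`,
`EFNetlist.lean`): the ripple-carry adder as a template of the netlist layer, the *view*
discipline under which its laws are stated, and the first law, commutativity, as a
polynomial-size block of constant-size inferences.

## Content

* `Adder.addT c₀ W`: the `W`-bit ripple-carry adder with carry-in constant `c₀` (wire `0` the
  carry-in, wire `2i+1` the sum bit `sᵢ = aᵢ ⊕ bᵢ ⊕ cᵢ`, wire `2i+2` the carry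
  `cᵢ₊₁ = maj(aᵢ, bᵢ, cᵢ)`), its index lemmas and well-formedness `Adder.wf_addT`.
* `Adder.View` (base of the gate variables + the two operand words as functions `ℕ → ℕ`),
  `View.Avail` (its contextualised definition lines are available), `Adder.avail_viewOf`
  (from an instance of `addT`), `Adder.avail_viewEmb` (from an adder embedded in a larger
  template). Laws are stated for views so that they apply verbatim to embedded adders.
* Rules `Adder.rules` (reflexivity of bit equality, commuted congruences of `⊕₃` and `maj`,
  sound by truth tables), `Adder.reflLines`, and the **commutativity law**
  `Adder.isBlock_commLines`: adders on `(a, b)` and `(b, a)` have provably equal carries and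
  sum bits, `2W + 1` lines of size `|K| + 10`.

## Sources

* S. A. Cook, R. A. Reckhow, *The relative efficiency of propositional proof systems*,
  J. Symbolic Logic 44 (1979), §2 (sound schematic rules), §4 (extension).
* H. Vollmer, *Introduction to Circuit Complexity* (Springer 1999), §1.1 (addition by
  ripple-carry circuits).
* S. R. Buss, *Bounded arithmetic* (1986) / J. Krajíček, *Bounded Arithmetic, Propositional
  Logic, and Complexity Theory* (1995), §9.2: the provenance of the claim that the elementary
  laws of binary arithmetic have polynomial-size extended Frege proofs (here constructed
  explicitly).
-/

namespace Literature.Computability.MetaComplexity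

open _root_.Computability Complexity Complexity.PropForm Netlist

namespace Adder

/-! ### The template -/

/-- The sum gate at position `i` of the `W`-bit ripple adder: `sᵢ = aᵢ ⊕ bᵢ ⊕ cᵢ`
(inputs `i`, `W + i`, carry wire `2i`). [cite: Vollmer1999, §1.1] -/
def sumGate (W i : ℕ) : TGate := ⟨Kind.xor3, [Sum.inl i, Sum.inl (W + i), Sum.inr (2 * i)]⟩

/-- The carry gate at position `i`: `cᵢ₊₁ = maj(aᵢ, bᵢ, cᵢ)`. [cite: Vollmer1999, §1.1] -/
def carryGate (W i : ℕ) : TGate := ⟨Kind.maj, [Sum.inl i, Sum.inl (W + i), Sum.inr (2 * i)]⟩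

/-- The first `n` positions of the `W`-bit ripple adder with carry-in constant `c₀`: wire `0`
is `c₀`, wire `2i + 1` the sum bit `sᵢ`, wire `2i + 2` the carry `cᵢ₊₁`.
[cite: Vollmer1999, §1.1 (addition)] -/
def gates (c₀ : Bool) (W : ℕ) : ℕ → Template
  | 0 => [⟨Kind.cst c₀, []⟩]
  | n + 1 => gates c₀ W n ++ [sumGate W n, carryGate W n]

/-- **The ripple-carry adder template** on two `W`-bit inputs (`a = inputs 0…W-1`,
`b = inputs W…2W-1`, least significant bit first) with carry-in `c₀`; outputs: sum bits
`s₀…s_{W-1}` (wires `2i+1`) and the carry-out `c_W` (wire `2W`), together the `W+1`-bit sum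
`a + b + c₀`. [cite: Vollmer1999, §1.1 (addition)] -/
def addT (c₀ : Bool) (W : ℕ) : Template := gates c₀ W W

/-- Unfolding one position of the adder. [folklore] -/
theorem gates_succ (c₀ : Bool) (W n : ℕ) :
    gates c₀ W (n + 1) = gates c₀ W n ++ [sumGate W n, carryGate W n] := rfl

/-- Number of gates of the first `n` positions. [folklore] -/
@[simp] theorem length_gates (c₀ : Bool) (W n : ℕ) : (gates c₀ W n).length = 2 * n + 1 := by
  induction n with
  | zero => rfl
  | succ n ih => simp [gates_succ, ih]; ring

/-- Number of gates of the adder. [folklore] -/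
@[simp] theorem length_addT (c₀ : Bool) (W : ℕ) : (addT c₀ W).length = 2 * W + 1 :=
  length_gates c₀ W W

/-- The gates by index: the carry-in, the sum gates (odd wires), the carry gates (even wires).
[folklore] -/
theorem getElem?_gates (c₀ : Bool) (W : ℕ) : ∀ (n : ℕ),
    (gates c₀ W n)[0]? = some ⟨Kind.cst c₀, []⟩ ∧
    ∀ i < n, (gates c₀ W n)[2 * i + 1]? = some (sumGate W i) ∧
      (gates c₀ W n)[2 * i + 2]? = some (carryGate W i)
  | 0 => ⟨rfl, fun i hi => absurd hi (Nat.not_lt_zero i)⟩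
  | n + 1 => by
    obtain ⟨h0, hi⟩ := getElem?_gates c₀ W n
    refine ⟨?_, fun i hin => ?_⟩
    · rw [gates_succ, List.getElem?_append_left (by simp), h0]
    · rcases Nat.lt_succ_iff_lt_or_eq.1 hin with hin | rfl
      · obtain ⟨h₁, h₂⟩ := hi i hin
        rw [gates_succ, List.getElem?_append_left (by simp; omega),
          List.getElem?_append_left (by simp; omega), h₁, h₂]
        exact ⟨rfl, rfl⟩
      · rw [gates_succ, List.getElem?_append_right (by simp),
          List.getElem?_append_right (by simp)]
        simp

/-- Wire `0` of the adder is the carry-in constant. [folklore] -/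
theorem addT_zero (c₀ : Bool) (W : ℕ) (h : 0 < (addT c₀ W).length) :
    (addT c₀ W)[0] = ⟨Kind.cst c₀, []⟩ :=
  Option.some_inj.1 (by rw [← List.getElem?_eq_getElem h]; exact (getElem?_gates c₀ W W).1)

/-- Wire `2i + 1` of the adder is the sum gate `i`. [folklore] -/
theorem addT_sum (c₀ : Bool) (W : ℕ) {i : ℕ} (hi : i < W) (h : 2 * i + 1 < (addT c₀ W).length) :
    (addT c₀ W)[2 * i + 1] = sumGate W i :=
  Option.some_inj.1 (by
    rw [← List.getElem?_eq_getElem h]; exact ((getElem?_gates c₀ W W).2 i hi).1)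

/-- Wire `2i + 2` of the adder is the carry gate `i`. [folklore] -/
theorem addT_carry (c₀ : Bool) (W : ℕ) {i : ℕ} (hi : i < W) (h : 2 * i + 2 < (addT c₀ W).length) :
    (addT c₀ W)[2 * i + 2] = carryGate W i :=
  Option.some_inj.1 (by
    rw [← List.getElem?_eq_getElem h]; exact ((getElem?_gates c₀ W W).2 i hi).2)

/-- Every index of the adder is `0`, `2i+1` or `2i+2` with `i < W`. [folklore] -/
theorem index_cases (W k : ℕ) (hk : k < 2 * W + 1) :
    k = 0 ∨ ∃ i < W, k = 2 * i + 1 ∨ k = 2 * i + 2 := by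
  rcases k with _ | k
  · exact Or.inl rfl
  · refine Or.inr ⟨k / 2, by omega, ?_⟩
    rcases Nat.even_or_odd k with ⟨j, hj⟩ | ⟨j, hj⟩ <;> omega

/-- **The adder template is well formed** (`2W` inputs). [cite: Vollmer1999, §1.1] -/
theorem wf_addT (c₀ : Bool) (W : ℕ) : (addT c₀ W).WF (2 * W) := by
  intro k hk
  rcases index_cases W k (by simpa using hk) with rfl | ⟨i, hi, rfl | rfl⟩
  · rw [addT_zero]
    exact ⟨rfl, fun a ha => absurd ha List.not_mem_nil⟩
  · rw [addT_sum c₀ W hi]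
    refine ⟨rfl, fun a ha => ?_⟩
    simp only [sumGate, List.mem_cons, List.not_mem_nil, or_false] at ha
    rcases ha with rfl | rfl | rfl <;> simp <;> omega
  · rw [addT_carry c₀ W hi]
    refine ⟨rfl, fun a ha => ?_⟩
    simp only [carryGate, List.mem_cons, List.not_mem_nil, or_false] at ha
    rcases ha with rfl | rfl | rfl <;> simp <;> omega

/-! ### Views: an adder by its base and input words

Laws are stated for *views* — the base index of the gates together with the variables carrying
the input bits, as functions `ℕ → ℕ` — rather than for instances, so that they apply verbatim
to adders embedded in larger templates (whose input lists do not reduce definitionally). -/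

/-- A view of a `W`-bit adder: the base of its gate variables and its two input words.
[folklore] -/
structure View where
  /-- the first gate variable -/
  base : ℕ
  /-- the variables of the first operand, by bit position -/
  x : ℕ → ℕ
  /-- the variables of the second operand, by bit position -/
  y : ℕ → ℕ

namespace View

/-- Gate variable `k` of the view (`2i` = carry `cᵢ`, `2i+1` = sum bit `sᵢ`). [folklore] -/
def wire (V : View) (k : ℕ) : ℕ := V.base + k

/-- The carry variable `cᵢ`. [folklore] -/
def c (V : View) (i : ℕ) : ℕ := V.wire (2 * i)

/-- The sum variable `sᵢ`. [folklore] -/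
def s (V : View) (i : ℕ) : ℕ := V.wire (2 * i + 1)

/-- The definition line of the carry-in: `c₀ ↔ const`. [folklore] -/
def cinDef (V : View) (c₀ : Bool) : PropForm ℕ := biimp (var (V.c 0)) (const c₀)

/-- The definition line of the sum bit `i`: `sᵢ ↔ xᵢ ⊕ yᵢ ⊕ cᵢ`. [folklore] -/
def sumDef (V : View) (i : ℕ) : PropForm ℕ :=
  biimp (var (V.s i)) (xor3F (var (V.x i)) (var (V.y i)) (var (V.c i)))

/-- The definition line of the carry `i+1`: `cᵢ₊₁ ↔ maj(xᵢ, yᵢ, cᵢ)`. [folklore] -/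
def carryDef (V : View) (i : ℕ) : PropForm ℕ :=
  biimp (var (V.c (i + 1))) (majF (var (V.x i)) (var (V.y i)) (var (V.c i)))

/-- `V.Avail K Γ c₀ W`: the contextualised definition lines of a `W`-bit adder with carry-in
`c₀` laid out according to the view are available in `Γ`. [folklore] -/
def Avail (V : View) (K : PropForm ℕ) (Γ : Set (PropForm ℕ)) (c₀ : Bool) (W : ℕ) : Prop :=
  ctx K (V.cinDef c₀) ∈ Γ ∧ ∀ i < W, ctx K (V.sumDef i) ∈ Γ ∧ ctx K (V.carryDef i) ∈ Γ

/-- Availability is monotone. [folklore] -/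
theorem Avail.mono {V : View} {K : PropForm ℕ} {Γ Γ' : Set (PropForm ℕ)} {c₀ : Bool} {W : ℕ}
    (h : V.Avail K Γ c₀ W) (hΓ : Γ ⊆ Γ') : V.Avail K Γ' c₀ W :=
  ⟨hΓ h.1, fun i hi => ⟨hΓ (h.2 i hi).1, hΓ (h.2 i hi).2⟩⟩

end View

/-- The view of an adder instance: its base and its input list split into the two operands.
[folklore] -/
def viewOf (P : Inst) (W : ℕ) : View :=
  ⟨P.base, fun i => P.inputs.getD i 0, fun i => P.inputs.getD (W + i) 0⟩

/-- **An adder instance whose definitions are available provides an available view.**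
[folklore] -/
theorem avail_viewOf {P : Inst} {K : PropForm ℕ} {Γ : Set (PropForm ℕ)} {c₀ : Bool} {W : ℕ}
    (hP : P.DefsAvail (addT c₀ W) K Γ) : (viewOf P W).Avail K Γ c₀ W := by
  refine ⟨?_, fun i hi => ⟨?_, ?_⟩⟩
  · have h := hP 0 (by simp)
    rwa [addT_zero] at h
  · have h := hP (2 * i + 1) (by simp; omega)
    rwa [addT_sum c₀ W hi] at h
  · have h := hP (2 * i + 2) (by simp; omega)
    rwa [addT_carry c₀ W hi] at h

/-- A general adder view inside an instance `I` of a template `t` that contains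
`embed (addT c₀ W) w off` at position `off`: base `I.base + off`, operands read through the
wiring `w`. [folklore] -/
def viewEmb (I : Inst) (w : ℕ → ℕ ⊕ ℕ) (off W : ℕ) : View :=
  ⟨I.base + off, fun i => I.ref (w i), fun i => I.ref (w (W + i))⟩

/-- **An embedded adder provides an available view**: if the definitions of `I` w.r.t. `t` are
available and `t` contains `embed (addT c₀ W) w off` at `off`, the view `viewEmb I w off W` is
available. [folklore] -/
theorem avail_viewEmb {I : Inst} {t : Template} {K : PropForm ℕ} {Γ : Set (PropForm ℕ)}
    {c₀ : Bool} {W off : ℕ} {w : ℕ → ℕ ⊕ ℕ} (hI : I.DefsAvail t K Γ)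
    (ht : ∀ (k : ℕ) (hk : k < (addT c₀ W).length), ∃ hk' : off + k < t.length,
      t[off + k] = ⟨((addT c₀ W)[k]).kind, ((addT c₀ W)[k]).args.map (remap w off)⟩) :
    (viewEmb I w off W).Avail K Γ c₀ W := by
  have hget : ∀ (k : ℕ) (hk : k < (addT c₀ W).length),
      ctx K (biimp (var (I.wire (off + k))) (I.body ⟨((addT c₀ W)[k]).kind,
        ((addT c₀ W)[k]).args.map (remap w off)⟩)) ∈ Γ := fun k hk => by
    obtain ⟨hk', heq⟩ := ht k hk
    have h := hI (off + k) hk'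
    rwa [heq] at h
  refine ⟨?_, fun i hi => ⟨?_, ?_⟩⟩
  · have h := hget 0 (by simp)
    rw [addT_zero] at h
    exact h
  · have h := hget (2 * i + 1) (by simp; omega)
    rw [addT_sum c₀ W hi] at h
    simpa [viewEmb, View.sumDef, View.s, View.c, View.wire, Inst.body, Inst.wire, sumGate,
      Kind.body, arg, remap, Inst.ref, Nat.add_assoc] using h
  · have h := hget (2 * i + 2) (by simp; omega)
    rw [addT_carry c₀ W hi] at h
    have h2 : 2 * (i + 1) = 2 * i + 2 := by ring
    simpa [viewEmb, View.carryDef, View.c, View.wire, Inst.body, Inst.wire, carryGate,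
      Kind.body, arg, remap, Inst.ref, Nat.add_assoc, h2] using h

/-! ### Rules of the adder layer -/

/-- Reflexivity of bit equality under a context: `⊢ K ∨ (a ↔ a)`. [cite: CookReckhow1979, §2] -/
def rRefl : FregeRule := ⟨[], ctx (var 0) (eqv 1 1)⟩

/-- Commuted congruence of `⊕₃`: `g = a ⊕ b ⊕ c`, `g' = a' ⊕ b' ⊕ c'` with `a ↔ b'`, `b ↔ a'`,
`c ↔ c'` give `g ↔ g'`. [cite: CookReckhow1979, §2 (sound rule)] -/
def rXor3Comm : FregeRule :=
  ⟨[ctx (var 0) (biimp (var 1) (xor3F (var 2) (var 3) (var 4))),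
    ctx (var 0) (biimp (var 5) (xor3F (var 6) (var 7) (var 8))),
    ctx (var 0) (eqv 2 7), ctx (var 0) (eqv 3 6), ctx (var 0) (eqv 4 8)],
   ctx (var 0) (eqv 1 5)⟩

/-- Commuted congruence of majority: as `rXor3Comm` for `maj`.
[cite: CookReckhow1979, §2 (sound rule)] -/
def rMajComm : FregeRule :=
  ⟨[ctx (var 0) (biimp (var 1) (majF (var 2) (var 3) (var 4))),
    ctx (var 0) (biimp (var 5) (majF (var 6) (var 7) (var 8))),
    ctx (var 0) (eqv 2 7), ctx (var 0) (eqv 3 6), ctx (var 0) (eqv 4 8)],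
   ctx (var 0) (eqv 1 5)⟩

/-- The rules of the adder layer. [cite: CookReckhow1979, §2] -/
def rules : List FregeRule := [rRefl, rXor3Comm, rMajComm]

/-- Every rule of the adder layer is sound (truth tables). [cite: CookReckhow1979, §2 (sound rule)] -/
theorem isSound_of_mem_rules : ∀ r ∈ rules, r.IsSound := by
  intro r hr
  simp only [rules, List.mem_cons, List.not_mem_nil, or_false] at hr
  rcases hr with rfl | rfl | rfl <;> exact FregeRule.isSound_of_check (by decide +kernel)

/-- Membership of the adder rules in `rules`. [folklore] -/
theorem mem_rules : rRefl ∈ rules ∧ rXor3Comm ∈ rules ∧ rMajComm ∈ rules := by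
  simp [rules]

variable {G : FregeSystem} {K : PropForm ℕ} {Γ : Set (PropForm ℕ)} {c₀ : Bool} {W : ℕ}

/-! ### Reflexivity lines -/

/-- Reflexivity lines `K ∨ (vᵢ ↔ vᵢ)` for a list of variables. [folklore] -/
def reflLines (K : PropForm ℕ) (vs : List ℕ) : List (PropForm ℕ) :=
  vs.map fun v => ctx K (eqv v v)

/-- Reflexivity lines form a block over any set. [cite: CookReckhow1979, §2] -/
theorem isBlock_reflLines (hG : ∀ r ∈ rules, r ∈ G.rules) (K : PropForm ℕ) (vs : List ℕ)
    (Γ : Set (PropForm ℕ)) : G.IsBlock Γ (reflLines K vs) :=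
  Scaffold.isBlock_of_forall fun θ hθ => by
    obtain ⟨v, -, rfl⟩ := List.mem_map.1 hθ
    exact Or.inr (FregeSystem.IsInferredFrom.of_rule (hG _ mem_rules.1)
      (FregeSystem.sub [K, var v]) rfl FregeSystem.prems_nil)

/-- The reflexivity line of a listed variable. [folklore] -/
theorem mem_reflLines {K : PropForm ℕ} {vs : List ℕ} {v : ℕ} (hv : v ∈ vs) :
    ctx K (eqv v v) ∈ reflLines K vs :=
  List.mem_map.2 ⟨v, hv, rfl⟩

/-- Size of the reflexivity lines. [folklore] -/
theorem proofSize_reflLines (K : PropForm ℕ) (vs : List ℕ) :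
    proofSize (reflLines K vs) = vs.length * (K.size + 10) := by
  induction vs with
  | nil => simp [reflLines, proofSize]
  | cons v vs ih =>
    simp only [reflLines, List.map_cons, Scaffold.proofSize_cons, List.length_cons] at ih ⊢
    rw [ih]
    simp [ctx, eqv, size, FregeSystem.size_biimp]
    ring

/-! ### Law: commutativity of the ripple adder -/

/-- The lines of the commutativity law: wire-by-wire equality of an adder `P` on `(a, b)` and
an adder `Q` on `(b, a)`. [folklore] -/
def commLines (P Q : View) (K : PropForm ℕ) (W : ℕ) : List (PropForm ℕ) :=
  (List.range (2 * W + 1)).map fun k => ctx K (eqv (P.wire k) (Q.wire k))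

/-- **Commutativity of ripple-carry addition inside Frege.** If the definitions of two adders
`P`, `Q` (same width and carry-in) are available together with the bit equalities
`xᵢ(P) ↔ yᵢ(Q)` and `yᵢ(P) ↔ xᵢ(Q)` of their operands, then the lines
`K ∨ (wire k(P) ↔ wire k(Q))` (carries and sum bits, in ripple order) form a block: `2W + 1`
inferences by the (commuted) congruences of the constants, `⊕₃` and `maj`.
[cite: CookReckhow1979, §2] -/
theorem isBlock_commLines (hGN : ∀ r ∈ Netlist.rules, r ∈ G.rules) (hG : ∀ r ∈ rules, r ∈ G.rules)
    (P Q : View) (hP : P.Avail K Γ c₀ W) (hQ : Q.Avail K Γ c₀ W)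
    (hab : ∀ i < W, ctx K (eqv (P.x i) (Q.y i)) ∈ Γ) (hba : ∀ i < W, ctx K (eqv (P.y i) (Q.x i)) ∈ Γ) :
    G.IsBlock Γ (commLines P Q K W) := by
  refine isBlock_map_range (2 * W + 1) fun k hk => Or.inr ?_
  rcases index_cases W k hk with rfl | ⟨i, hi, rfl | rfl⟩
  · -- the carry-in constants
    exact FregeSystem.IsInferredFrom.of_rule (hGN _ (rLeib_mem_rules (Kind.cst c₀)))
      (FregeSystem.sub [K, var (P.c 0), const true, const true, const true, var (Q.c 0)])
      rfl (FregeSystem.prems_cons (Or.inl hP.1) (FregeSystem.prems_cons (Or.inl hQ.1)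
        FregeSystem.prems_nil))
  · -- sum bit `i`
    exact FregeSystem.IsInferredFrom.of_rule (hG _ mem_rules.2.1)
      (FregeSystem.sub [K, var (P.s i), var (P.x i), var (P.y i), var (P.c i), var (Q.s i),
        var (Q.x i), var (Q.y i), var (Q.c i)])
      rfl (FregeSystem.prems_cons (Or.inl (hP.2 i hi).1) (FregeSystem.prems_cons
        (Or.inl (hQ.2 i hi).1) (FregeSystem.prems_cons (Or.inl (hab i hi))
        (FregeSystem.prems_cons (Or.inl (hba i hi)) (FregeSystem.prems_cons
        (Or.inr ⟨2 * i, by omega, rfl⟩) FregeSystem.prems_nil)))))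
  · -- carry `i + 1`
    exact FregeSystem.IsInferredFrom.of_rule (hG _ mem_rules.2.2)
      (FregeSystem.sub [K, var (P.c (i + 1)), var (P.x i), var (P.y i), var (P.c i),
        var (Q.c (i + 1)), var (Q.x i), var (Q.y i), var (Q.c i)])
      rfl (FregeSystem.prems_cons (Or.inl (hP.2 i hi).2) (FregeSystem.prems_cons
        (Or.inl (hQ.2 i hi).2) (FregeSystem.prems_cons (Or.inl (hab i hi))
        (FregeSystem.prems_cons (Or.inl (hba i hi)) (FregeSystem.prems_cons
        (Or.inr ⟨2 * i, by omega, rfl⟩) FregeSystem.prems_nil)))))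

/-- The conclusions of the commutativity law: all wires, in particular the sum bits
(`k = 2i+1`) and the carry-out (`k = 2W`), are equal. [folklore] -/
theorem mem_commLines {P Q : View} {K : PropForm ℕ} {W k : ℕ} (hk : k < 2 * W + 1) :
    ctx K (eqv (P.wire k) (Q.wire k)) ∈ commLines P Q K W :=
  mem_map_range hk

/-- Size of the commutativity law: `2W + 1` lines of size `|K| + 10`. [folklore] -/
theorem proofSize_commLines (P Q : View) (K : PropForm ℕ) (W : ℕ) :
    proofSize (commLines P Q K W) ≤ (2 * W + 1) * (K.size + 10) :=
  proofSize_map_range_le fun k _ => by simp [ctx, eqv, size, FregeSystem.size_biimp]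

end Adder

end Literature.Computability.MetaComplexity
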